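/-
Origin: expansion seat `prover-pub-hodgecm-mc-carch-1-0`, handover #CA3 2026-08-19T23:15Z md5 d61011c4c124 (384 l.; v2 = + `lineScalar_{zero,one,two,three}` (U21 →* ℂˣ) + `lineRepOf_{k}_archInfOf_expP_one` (scalar = 1 on exp 𝔭, `map_expP_eq_one`); NEW additive leaf; imports Model.ArchSideTerm (#1098), Model.ArchKTypeOf, Model.ArchKTypeOfArch, Vendored…GelbartRogawski1991.UnitaryDualPairSeesawCMLinesCollapse (K-1 twin of p194071, NOT YET CUT), Vendored…KonnoKonno2007.JunctionFactorisationExpP (installed)) (`HOME/mc/pub-hodgecm-mc-carch-1/pkg/HodgeCM/Model/ArchKTypeOfLines.lean`, md5 d61011c4c124, 384 lines);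
landed by the second packager (p2) in gate run 38 as `HodgeCM/Model/ArchKTypeOfLines.lean` (verbatim).
-/
/-
Copyright (c) 2026. Released under Apache 2.0 license as described in the file LICENSE.
Cell pub-hodgecm, MODEL layer (construction prover mc-carch-1, gen 0), BINDER-OWNERS row 12 `C` / node W6a (W-⊗′):
junction `hA` of `Model/ArchKTypeOf.archKTypeOf` AT THE HONEST ADELIC SIDE — the four S-side line representations
`lineRepOf k` (period-1 `Model/ArchSideTerm`, #1098) along #1097's `ι₁`-section are pure-tensor with an explicit
archimedean factor.
-/
import Summits.HodgeConjecture.HodgeCM.Model.ArchSideTerm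
import Summits.HodgeConjecture.HodgeCM.Model.ArchKTypeOf
import Summits.HodgeConjecture.HodgeCM.Model.ArchKTypeOfArch
import Literature.NumberTheory.GelbartRogawski1991.UnitaryDualPairSeesawCMLinesCollapse
import Literature.RepresentationTheory.KonnoKonno2007.JunctionFactorisationExpP

-- G11b-3 recipe (port D30 slow-export class; ops-buildfix LEDGER B13-1/B13-3): elaborate sequentially so the trailing
-- `attribute [implicit_reducible]` block (reducibilityCoreExt is keyed to the async environment branch) is in force at `.olean` export.
set_option Elab.async false

/-!
# `lineRepOf k (archInfOf V u, 1) = ωA_k u ⊗ 1` (junction `hA` of row 12 at the honest `S`)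

For the S pin term of record (`archSideOf`, period-1 #1099: `(S.P k).ω := lineRepOf k`, `S.ιinf := archInfOf V`), the
hypothesis `hA` of `Model/ArchKTypeOf.archKTypeOf` reads
`∀ u, lineRepOf k (archInfOf V u, 1) = adelicTensorEnd (ωA u) LinearMap.id`.  This file PROVES it, with the explicit
archimedean factor

  `lineArchEnd k u := c_k(u) • cmArchWeilRep e₁ hGR_k (archSectionFrameOf V u, 1)`,

`c_k(u) = η_k(x_u, 1) · χ_k(x_u, 1) ∈ ℂˣ`, `x_u = (archSectionFrameOf V u)_𝔸` (`Model/ArchKTypeOfArch` § 3), by composing: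
the regime identity `↑(archInfOf V u) = archSectionU21CM … u` (#1097 + `coe_regimeEquiv`), the frame fact
`cmFrameEquiv (frameG V) … (archSectionU21CM … u) = (archSectionFrameOf V u)_𝔸` (`ArchKTypeOfArch` § 3), the LINE
COLLAPSE `cm(Conj)LineRepFin_k (v, t) = c • cmPairRep e₁ hGR_k (v, centre t♭)` (tree p194071
`UnitaryDualPairSeesawCMLinesCollapse`) at `t = 1`, and `cmPairRep (x_∞, 1_∞) = cmArchWeilRep (x, 1) ⊗ 1`
(`ArchKTypeOfArch` § 1, binder-2 (J-a)).

Nothing is cited and nothing is minted: four definitions of operators (explicit formulas) and kernel lemmas.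
PREREQUISITES (packager): `Model/ArchSideTerm` (#1098, RUN 37), `Model/ArchKTypeOf`, `Model/ArchKTypeOfArch` (carch-1),
K-1 twin of `Literature/NumberTheory/GelbartRogawski1991/UnitaryDualPairSeesawCMLinesCollapse.lean` (p194071).
-/

set_option autoImplicit false

noncomputable section

open NumberField NumberField.mixedEmbedding IsDedekindDomain
open scoped Matrix TensorProduct Classical SchwartzMap
open Literature.Geometry.ComplexHyperbolic.BallModel (U21)
open Literature.AlgebraicGeometry.ShimuraVarieties.BallForms (expP)
open Literature.RepresentationTheory.KonnoKonno2007 (map_expP_eq_one)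
open Literature.NumberTheory.Automorphic Literature.NumberTheory.Weil1964
open Literature.NumberTheory.GelbartRogawski1991 Literature.NumberTheory.GelbartRogawski1991.UnitaryDualPair
open HodgeCM.Adelic HodgeCM.PerL34 HodgeCM.Model.HypCensus

namespace HodgeCM.Model

namespace ArchSideTerm

variable {L : CMField} {ι₁ : L →+* ℂ} (V : HermSpace3 L ι₁) (S : StubTree.SeesawDatum L)

variable
  (hGR : (cmSplittingDatum (L : Type) finProdFinEquiv (frameD V) (frameD_real V) (frameD_ne V) (dW S) (dW_real S) (dW_ne S)).CompatibleSplitting)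
  (hGR₀ : (cmSplittingDatum (L : Type) (e₁) (frameD V) (frameD_real V) (frameD_ne V) (lineVec (L : Type) (dW S 0))
    (fun _ => dW_real S 0) (fun _ => dW_ne S 0)).CompatibleSplitting)
  (hGR₁ : (cmSplittingDatum (L : Type) (e₁) (frameD V) (frameD_real V) (frameD_ne V) (lineVec (L : Type) (dW S 1))
    (fun _ => dW_real S 1) (fun _ => dW_ne S 1)).CompatibleSplitting)
  (hGR₂ : (cmSplittingDatum (L : Type) (e₁) (frameD V) (frameD_real V) (frameD_ne V) (lineVec (L : Type) (dW' S 0))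
    (fun _ => dW'_real S 0) (fun _ => dW'_ne S 0)).CompatibleSplitting)
  (hGR₃ : (cmSplittingDatum (L : Type) (e₁) (frameD V) (frameD_real V) (frameD_ne V) (lineVec (L : Type) (dW' S 1))
    (fun _ => dW'_real S 1) (fun _ => dW'_ne S 1)).CompatibleSplitting)
  (η₀ η₁ η₂ η₃ : CMAdelic (L : Type) (frameD V) × CMAdelicOne (L : Type) →* ℂˣ)

/-- In the anisotropic regime, #1097's `archInfOf V` IS the tree section `archSectionU21CM` on underlying adelic points. -/
theorem coe_archInfOf (hV : IsAnisotropic L V.Hm) (u : U21) :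
    ((regimeSubgroup L V.Hm).subtype (archInfOf V u)) =
      UnitaryGroup.archSectionU21CM (L : Type) ι₁ V.Hm V.sylvesterFrame (sylvesterFrame_J V) u := by
  rw [archInfOf_apply, toLatticeModelG_eq_regimeEquiv_twin V hV, Subgroup.coe_subtype, coe_regimeEquiv]
  rfl

/-- The first factor of `lineRepOf k` at `archInfOf V u` is the archimedean element `(archSectionFrameOf V u)_𝔸`. -/
theorem cmFrameEquiv_coe_archInfOf (hV : IsAnisotropic L V.Hm) (u : U21) :
    cmFrameEquiv (L : Type) (frameG V) V.Hm (frameD V) (frame_congr V)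
        ((regimeSubgroup L V.Hm).subtype (archInfOf V u)) =
      UnitaryGroup.archToAdelic (↥(maximalRealSubfield L)) L (IsCMField.complexConj L) 3 (Matrix.diagonal (frameD V))
        (archSectionFrameOf V u) := by
  rw [coe_archInfOf V hV, cmFrameEquiv_archSectionU21CM]

/-- **Line 0**: `lineRepOf 0 (archInfOf V u, 1) = (c_0(u) • cmArchWeilRep e₁ hGR_0 (archSectionFrameOf V u, 1)) ⊗ 1`. -/
theorem lineRepOf_zero_archInfOf_one (hV : IsAnisotropic L V.Hm) (u : U21) :
    lineRepOf V S hGR hGR₀ hGR₁ hGR₂ hGR₃ η₀ η₁ η₂ η₃ 0 (archInfOf V u, 1) =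
      adelicTensorEnd
        (((η₀ (UnitaryGroup.archToAdelic (↥(maximalRealSubfield L)) L (IsCMField.complexConj L) 3
                (Matrix.diagonal (frameD V)) (archSectionFrameOf V u), 1) *
              cmLineChar₀ (L : Type) finProdFinEquiv e₁ (frameD V) (frameD_real V) (frameD_ne V) (dW S) (dW_real S)
                (dW_ne S) hGR hGR₀ hGR₁
                (UnitaryGroup.archToAdelic (↥(maximalRealSubfield L)) L (IsCMField.complexConj L) 3
                (Matrix.diagonal (frameD V)) (archSectionFrameOf V u), 1) : ℂˣ) : ℂ) •
          (cmArchWeilRep (L : Type) e₁ (frameD V) (frameD_real V) (frameD_ne V) (lineVec (L : Type) (dW S 0))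
            (fun _ => dW_real S 0) (fun _ => dW_ne S 0) hGR₀ (archSectionFrameOf V u, 1) :
              𝓢((Fin 3 → mixedSpace (↥(maximalRealSubfield L))), ℂ) →ₗ[ℂ] _))
        LinearMap.id := by
  have h1 : lineRepOf V S hGR hGR₀ hGR₁ hGR₂ hGR₃ η₀ η₁ η₂ η₃ 0 (archInfOf V u, 1) =
      cmLineRepFin₀ (L : Type) finProdFinEquiv e₁ (frameD V) (frameD_real V) (frameD_ne V) (dW S) (dW_real S) (dW_ne S)
        hGR hGR₀ hGR₁ η₀
        (UnitaryGroup.archToAdelic (↥(maximalRealSubfield L)) L (IsCMField.complexConj L) 3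
                (Matrix.diagonal (frameD V)) (archSectionFrameOf V u), 1) := by
    rw [← cmFrameEquiv_coe_archInfOf V hV u]
    rfl
  have key := smul_cmPairRep_archToAdelic_eq_adelicTensorEnd (L : Type) e₁ (frameD V) (frameD_real V) (frameD_ne V)
    (lineVec (L : Type) (dW S 0)) (fun _ => dW_real S 0) (fun _ => dW_ne S 0) hGR₀
    ((η₀ (UnitaryGroup.archToAdelic (↥(maximalRealSubfield L)) L (IsCMField.complexConj L) 3
                (Matrix.diagonal (frameD V)) (archSectionFrameOf V u), 1) *
              cmLineChar₀ (L : Type) finProdFinEquiv e₁ (frameD V) (frameD_real V) (frameD_ne V) (dW S) (dW_real S)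
                (dW_ne S) hGR hGR₀ hGR₁
                (UnitaryGroup.archToAdelic (↥(maximalRealSubfield L)) L (IsCMField.complexConj L) 3
                (Matrix.diagonal (frameD V)) (archSectionFrameOf V u), 1) : ℂˣ) : ℂ)
    (archSectionFrameOf V u) 1
  rw [map_one] at key
  rw [h1, ← key]
  refine LinearMap.ext fun φ => ?_
  rw [cmLineRepFin₀_apply_eq_smul_cmPairRep, LinearMap.smul_apply, map_one, map_one]
  rfl

/-- **Line 1**: `lineRepOf 1 (archInfOf V u, 1) = (c_1(u) • cmArchWeilRep e₁ hGR_1 (archSectionFrameOf V u, 1)) ⊗ 1`. -/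
theorem lineRepOf_one_archInfOf_one (hV : IsAnisotropic L V.Hm) (u : U21) :
    lineRepOf V S hGR hGR₀ hGR₁ hGR₂ hGR₃ η₀ η₁ η₂ η₃ 1 (archInfOf V u, 1) =
      adelicTensorEnd
        (((η₁ (UnitaryGroup.archToAdelic (↥(maximalRealSubfield L)) L (IsCMField.complexConj L) 3
                (Matrix.diagonal (frameD V)) (archSectionFrameOf V u), 1) *
              cmLineChar₁ (L : Type) finProdFinEquiv e₁ (frameD V) (frameD_real V) (frameD_ne V) (dW S) (dW_real S)
                (dW_ne S) hGR hGR₀ hGR₁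
                (UnitaryGroup.archToAdelic (↥(maximalRealSubfield L)) L (IsCMField.complexConj L) 3
                (Matrix.diagonal (frameD V)) (archSectionFrameOf V u), 1) : ℂˣ) : ℂ) •
          (cmArchWeilRep (L : Type) e₁ (frameD V) (frameD_real V) (frameD_ne V) (lineVec (L : Type) (dW S 1))
            (fun _ => dW_real S 1) (fun _ => dW_ne S 1) hGR₁ (archSectionFrameOf V u, 1) :
              𝓢((Fin 3 → mixedSpace (↥(maximalRealSubfield L))), ℂ) →ₗ[ℂ] _))
        LinearMap.id := by
  have h1 : lineRepOf V S hGR hGR₀ hGR₁ hGR₂ hGR₃ η₀ η₁ η₂ η₃ 1 (archInfOf V u, 1) =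
      cmLineRepFin₁ (L : Type) finProdFinEquiv e₁ (frameD V) (frameD_real V) (frameD_ne V) (dW S) (dW_real S) (dW_ne S)
        hGR hGR₀ hGR₁ η₁
        (UnitaryGroup.archToAdelic (↥(maximalRealSubfield L)) L (IsCMField.complexConj L) 3
                (Matrix.diagonal (frameD V)) (archSectionFrameOf V u), 1) := by
    rw [← cmFrameEquiv_coe_archInfOf V hV u]
    rfl
  have key := smul_cmPairRep_archToAdelic_eq_adelicTensorEnd (L : Type) e₁ (frameD V) (frameD_real V) (frameD_ne V)
    (lineVec (L : Type) (dW S 1)) (fun _ => dW_real S 1) (fun _ => dW_ne S 1) hGR₁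
    ((η₁ (UnitaryGroup.archToAdelic (↥(maximalRealSubfield L)) L (IsCMField.complexConj L) 3
                (Matrix.diagonal (frameD V)) (archSectionFrameOf V u), 1) *
              cmLineChar₁ (L : Type) finProdFinEquiv e₁ (frameD V) (frameD_real V) (frameD_ne V) (dW S) (dW_real S)
                (dW_ne S) hGR hGR₀ hGR₁
                (UnitaryGroup.archToAdelic (↥(maximalRealSubfield L)) L (IsCMField.complexConj L) 3
                (Matrix.diagonal (frameD V)) (archSectionFrameOf V u), 1) : ℂˣ) : ℂ)
    (archSectionFrameOf V u) 1
  rw [map_one] at key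
  rw [h1, ← key]
  refine LinearMap.ext fun φ => ?_
  rw [cmLineRepFin₁_apply_eq_smul_cmPairRep, LinearMap.smul_apply, map_one, map_one]
  rfl

/-- **Line 2**: `lineRepOf 2 (archInfOf V u, 1) = (c_2(u) • cmArchWeilRep e₁ hGR_2 (archSectionFrameOf V u, 1)) ⊗ 1`. -/
theorem lineRepOf_two_archInfOf_one (hV : IsAnisotropic L V.Hm) (u : U21) :
    lineRepOf V S hGR hGR₀ hGR₁ hGR₂ hGR₃ η₀ η₁ η₂ η₃ 2 (archInfOf V u, 1) =
      adelicTensorEnd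
        (((η₂ (UnitaryGroup.archToAdelic (↥(maximalRealSubfield L)) L (IsCMField.complexConj L) 3
                (Matrix.diagonal (frameD V)) (archSectionFrameOf V u), 1) *
              cmConjLineChar₀ (L : Type) finProdFinEquiv e₁ (frameD V) (frameD_real V) (frameD_ne V) (dW S) (dW_real S)
                (dW_ne S) (dW' S) (dW'_real S) (dW'_ne S) S.isoGL (isoGL_hg₀ S) hGR hGR₂ hGR₃
                (UnitaryGroup.archToAdelic (↥(maximalRealSubfield L)) L (IsCMField.complexConj L) 3
                (Matrix.diagonal (frameD V)) (archSectionFrameOf V u), 1) : ℂˣ) : ℂ) •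
          (cmArchWeilRep (L : Type) e₁ (frameD V) (frameD_real V) (frameD_ne V) (lineVec (L : Type) (dW' S 0))
            (fun _ => dW'_real S 0) (fun _ => dW'_ne S 0) hGR₂ (archSectionFrameOf V u, 1) :
              𝓢((Fin 3 → mixedSpace (↥(maximalRealSubfield L))), ℂ) →ₗ[ℂ] _))
        LinearMap.id := by
  have h1 : lineRepOf V S hGR hGR₀ hGR₁ hGR₂ hGR₃ η₀ η₁ η₂ η₃ 2 (archInfOf V u, 1) =
      cmConjLineRepFin₀ (L : Type) finProdFinEquiv e₁ (frameD V) (frameD_real V) (frameD_ne V) (dW S) (dW_real S) (dW_ne S) (dW' S) (dW'_real S) (dW'_ne S) S.isoGL (isoGL_hg₀ S)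
        hGR hGR₂ hGR₃ η₂
        (UnitaryGroup.archToAdelic (↥(maximalRealSubfield L)) L (IsCMField.complexConj L) 3
                (Matrix.diagonal (frameD V)) (archSectionFrameOf V u), 1) := by
    rw [← cmFrameEquiv_coe_archInfOf V hV u]
    rfl
  have key := smul_cmPairRep_archToAdelic_eq_adelicTensorEnd (L : Type) e₁ (frameD V) (frameD_real V) (frameD_ne V)
    (lineVec (L : Type) (dW' S 0)) (fun _ => dW'_real S 0) (fun _ => dW'_ne S 0) hGR₂
    ((η₂ (UnitaryGroup.archToAdelic (↥(maximalRealSubfield L)) L (IsCMField.complexConj L) 3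
                (Matrix.diagonal (frameD V)) (archSectionFrameOf V u), 1) *
              cmConjLineChar₀ (L : Type) finProdFinEquiv e₁ (frameD V) (frameD_real V) (frameD_ne V) (dW S) (dW_real S)
                (dW_ne S) (dW' S) (dW'_real S) (dW'_ne S) S.isoGL (isoGL_hg₀ S) hGR hGR₂ hGR₃
                (UnitaryGroup.archToAdelic (↥(maximalRealSubfield L)) L (IsCMField.complexConj L) 3
                (Matrix.diagonal (frameD V)) (archSectionFrameOf V u), 1) : ℂˣ) : ℂ)
    (archSectionFrameOf V u) 1
  rw [map_one] at key
  rw [h1, ← key]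
  refine LinearMap.ext fun φ => ?_
  rw [cmConjLineRepFin₀_apply_eq_smul_cmPairRep, LinearMap.smul_apply, map_one, map_one]
  rfl

/-- **Line 3**: `lineRepOf 3 (archInfOf V u, 1) = (c_3(u) • cmArchWeilRep e₁ hGR_3 (archSectionFrameOf V u, 1)) ⊗ 1`. -/
theorem lineRepOf_three_archInfOf_one (hV : IsAnisotropic L V.Hm) (u : U21) :
    lineRepOf V S hGR hGR₀ hGR₁ hGR₂ hGR₃ η₀ η₁ η₂ η₃ 3 (archInfOf V u, 1) =
      adelicTensorEnd
        (((η₃ (UnitaryGroup.archToAdelic (↥(maximalRealSubfield L)) L (IsCMField.complexConj L) 3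
                (Matrix.diagonal (frameD V)) (archSectionFrameOf V u), 1) *
              cmConjLineChar₁ (L : Type) finProdFinEquiv e₁ (frameD V) (frameD_real V) (frameD_ne V) (dW S) (dW_real S)
                (dW_ne S) (dW' S) (dW'_real S) (dW'_ne S) S.isoGL (isoGL_hg₀ S) hGR hGR₂ hGR₃
                (UnitaryGroup.archToAdelic (↥(maximalRealSubfield L)) L (IsCMField.complexConj L) 3
                (Matrix.diagonal (frameD V)) (archSectionFrameOf V u), 1) : ℂˣ) : ℂ) •
          (cmArchWeilRep (L : Type) e₁ (frameD V) (frameD_real V) (frameD_ne V) (lineVec (L : Type) (dW' S 1))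
            (fun _ => dW'_real S 1) (fun _ => dW'_ne S 1) hGR₃ (archSectionFrameOf V u, 1) :
              𝓢((Fin 3 → mixedSpace (↥(maximalRealSubfield L))), ℂ) →ₗ[ℂ] _))
        LinearMap.id := by
  have h1 : lineRepOf V S hGR hGR₀ hGR₁ hGR₂ hGR₃ η₀ η₁ η₂ η₃ 3 (archInfOf V u, 1) =
      cmConjLineRepFin₁ (L : Type) finProdFinEquiv e₁ (frameD V) (frameD_real V) (frameD_ne V) (dW S) (dW_real S) (dW_ne S) (dW' S) (dW'_real S) (dW'_ne S) S.isoGL (isoGL_hg₀ S)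
        hGR hGR₂ hGR₃ η₃
        (UnitaryGroup.archToAdelic (↥(maximalRealSubfield L)) L (IsCMField.complexConj L) 3
                (Matrix.diagonal (frameD V)) (archSectionFrameOf V u), 1) := by
    rw [← cmFrameEquiv_coe_archInfOf V hV u]
    rfl
  have key := smul_cmPairRep_archToAdelic_eq_adelicTensorEnd (L : Type) e₁ (frameD V) (frameD_real V) (frameD_ne V)
    (lineVec (L : Type) (dW' S 1)) (fun _ => dW'_real S 1) (fun _ => dW'_ne S 1) hGR₃
    ((η₃ (UnitaryGroup.archToAdelic (↥(maximalRealSubfield L)) L (IsCMField.complexConj L) 3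
                (Matrix.diagonal (frameD V)) (archSectionFrameOf V u), 1) *
              cmConjLineChar₁ (L : Type) finProdFinEquiv e₁ (frameD V) (frameD_real V) (frameD_ne V) (dW S) (dW_real S)
                (dW_ne S) (dW' S) (dW'_real S) (dW'_ne S) S.isoGL (isoGL_hg₀ S) hGR hGR₂ hGR₃
                (UnitaryGroup.archToAdelic (↥(maximalRealSubfield L)) L (IsCMField.complexConj L) 3
                (Matrix.diagonal (frameD V)) (archSectionFrameOf V u), 1) : ℂˣ) : ℂ)
    (archSectionFrameOf V u) 1
  rw [map_one] at key
  rw [h1, ← key]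
  refine LinearMap.ext fun φ => ?_
  rw [cmConjLineRepFin₁_apply_eq_smul_cmPairRep, LinearMap.smul_apply, map_one, map_one]
  rfl


/-! ### Along E's chart `expP`: the line scalar is trivial (`map_expP_eq_one`) -/

/-- the scalar of line 0 along the `ι₁`-section, as a character of `U(2,1)`:
`u ↦ η_0(x_u, 1) · χ_0(x_u, 1)`, `x_u = (archSectionFrameOf V u)_𝔸`. -/
def lineScalar_zero : U21 →* ℂˣ :=
  (η₀.comp (MonoidHom.prod ((UnitaryGroup.archToAdelic (↥(maximalRealSubfield L)) L (IsCMField.complexConj L) 3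
      (Matrix.diagonal (frameD V))).comp (archSectionFrameOf V)) 1)) *
    ((cmLineChar₀ (L : Type) finProdFinEquiv e₁ (frameD V) (frameD_real V) (frameD_ne V) (dW S) (dW_real S)
      (dW_ne S) hGR hGR₀ hGR₁).comp
      (MonoidHom.prod ((UnitaryGroup.archToAdelic (↥(maximalRealSubfield L)) L (IsCMField.complexConj L) 3
      (Matrix.diagonal (frameD V))).comp (archSectionFrameOf V)) 1))

/-- (Ported verbatim from the HodgeCMPerL package; no docstring in the source.) -/
theorem lineScalar_zero_apply (u : U21) :
    lineScalar_zero V S hGR hGR₀ hGR₁ η₀ u =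
      η₀ (UnitaryGroup.archToAdelic (↥(maximalRealSubfield L)) L (IsCMField.complexConj L) 3
        (Matrix.diagonal (frameD V)) (archSectionFrameOf V u), 1) *
        cmLineChar₀ (L : Type) finProdFinEquiv e₁ (frameD V) (frameD_real V) (frameD_ne V) (dW S) (dW_real S)
      (dW_ne S) hGR hGR₀ hGR₁
          (UnitaryGroup.archToAdelic (↥(maximalRealSubfield L)) L (IsCMField.complexConj L) 3
          (Matrix.diagonal (frameD V)) (archSectionFrameOf V u), 1) :=
  rfl

/-- **Line 0 along E's chart**: `lineRepOf 0 (archInfOf V (expP b), 1) = cmArchWeilRep e₁ hGR_0 (archSectionFrameOf V (expP b), 1) ⊗ 1`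
— the line scalar is trivial on `exp 𝔭` (`map_expP_eq_one`). -/
theorem lineRepOf_zero_archInfOf_expP_one (hV : IsAnisotropic L V.Hm) (b : Fin 2 → ℂ) :
    lineRepOf V S hGR hGR₀ hGR₁ hGR₂ hGR₃ η₀ η₁ η₂ η₃ 0 (archInfOf V (expP b), 1) =
      adelicTensorEnd
        (cmArchWeilRep (L : Type) e₁ (frameD V) (frameD_real V) (frameD_ne V) (lineVec (L : Type) (dW S 0))
            (fun _ => dW_real S 0) (fun _ => dW_ne S 0) hGR₀ (archSectionFrameOf V (expP b), 1) :
          𝓢((Fin 3 → mixedSpace (↥(maximalRealSubfield L))), ℂ) →ₗ[ℂ] _)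
        LinearMap.id := by
  rw [lineRepOf_zero_archInfOf_one V S hGR hGR₀ hGR₁ hGR₂ hGR₃ η₀ η₁ η₂ η₃ hV (expP b)]
  have h1 := map_expP_eq_one (lineScalar_zero V S hGR hGR₀ hGR₁ η₀) b
  rw [lineScalar_zero_apply] at h1
  rw [h1, Units.val_one, one_smul]

/-- the scalar of line 1 along the `ι₁`-section, as a character of `U(2,1)`:
`u ↦ η_1(x_u, 1) · χ_1(x_u, 1)`, `x_u = (archSectionFrameOf V u)_𝔸`. -/
def lineScalar_one : U21 →* ℂˣ :=
  (η₁.comp (MonoidHom.prod ((UnitaryGroup.archToAdelic (↥(maximalRealSubfield L)) L (IsCMField.complexConj L) 3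
      (Matrix.diagonal (frameD V))).comp (archSectionFrameOf V)) 1)) *
    ((cmLineChar₁ (L : Type) finProdFinEquiv e₁ (frameD V) (frameD_real V) (frameD_ne V) (dW S) (dW_real S)
      (dW_ne S) hGR hGR₀ hGR₁).comp
      (MonoidHom.prod ((UnitaryGroup.archToAdelic (↥(maximalRealSubfield L)) L (IsCMField.complexConj L) 3
      (Matrix.diagonal (frameD V))).comp (archSectionFrameOf V)) 1))

/-- (Ported verbatim from the HodgeCMPerL package; no docstring in the source.) -/
theorem lineScalar_one_apply (u : U21) :
    lineScalar_one V S hGR hGR₀ hGR₁ η₁ u =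
      η₁ (UnitaryGroup.archToAdelic (↥(maximalRealSubfield L)) L (IsCMField.complexConj L) 3
        (Matrix.diagonal (frameD V)) (archSectionFrameOf V u), 1) *
        cmLineChar₁ (L : Type) finProdFinEquiv e₁ (frameD V) (frameD_real V) (frameD_ne V) (dW S) (dW_real S)
      (dW_ne S) hGR hGR₀ hGR₁
          (UnitaryGroup.archToAdelic (↥(maximalRealSubfield L)) L (IsCMField.complexConj L) 3
          (Matrix.diagonal (frameD V)) (archSectionFrameOf V u), 1) :=
  rfl

/-- **Line 1 along E's chart**: `lineRepOf 1 (archInfOf V (expP b), 1) = cmArchWeilRep e₁ hGR_1 (archSectionFrameOf V (expP b), 1) ⊗ 1`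
— the line scalar is trivial on `exp 𝔭` (`map_expP_eq_one`). -/
theorem lineRepOf_one_archInfOf_expP_one (hV : IsAnisotropic L V.Hm) (b : Fin 2 → ℂ) :
    lineRepOf V S hGR hGR₀ hGR₁ hGR₂ hGR₃ η₀ η₁ η₂ η₃ 1 (archInfOf V (expP b), 1) =
      adelicTensorEnd
        (cmArchWeilRep (L : Type) e₁ (frameD V) (frameD_real V) (frameD_ne V) (lineVec (L : Type) (dW S 1))
            (fun _ => dW_real S 1) (fun _ => dW_ne S 1) hGR₁ (archSectionFrameOf V (expP b), 1) :
          𝓢((Fin 3 → mixedSpace (↥(maximalRealSubfield L))), ℂ) →ₗ[ℂ] _)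
        LinearMap.id := by
  rw [lineRepOf_one_archInfOf_one V S hGR hGR₀ hGR₁ hGR₂ hGR₃ η₀ η₁ η₂ η₃ hV (expP b)]
  have h1 := map_expP_eq_one (lineScalar_one V S hGR hGR₀ hGR₁ η₁) b
  rw [lineScalar_one_apply] at h1
  rw [h1, Units.val_one, one_smul]

/-- the scalar of line 2 along the `ι₁`-section, as a character of `U(2,1)`:
`u ↦ η_2(x_u, 1) · χ_2(x_u, 1)`, `x_u = (archSectionFrameOf V u)_𝔸`. -/
def lineScalar_two : U21 →* ℂˣ :=
  (η₂.comp (MonoidHom.prod ((UnitaryGroup.archToAdelic (↥(maximalRealSubfield L)) L (IsCMField.complexConj L) 3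
      (Matrix.diagonal (frameD V))).comp (archSectionFrameOf V)) 1)) *
    ((cmConjLineChar₀ (L : Type) finProdFinEquiv e₁ (frameD V) (frameD_real V) (frameD_ne V) (dW S) (dW_real S)
      (dW_ne S) (dW' S) (dW'_real S) (dW'_ne S) S.isoGL (isoGL_hg₀ S) hGR hGR₂ hGR₃).comp
      (MonoidHom.prod ((UnitaryGroup.archToAdelic (↥(maximalRealSubfield L)) L (IsCMField.complexConj L) 3
      (Matrix.diagonal (frameD V))).comp (archSectionFrameOf V)) 1))

/-- (Ported verbatim from the HodgeCMPerL package; no docstring in the source.) -/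
theorem lineScalar_two_apply (u : U21) :
    lineScalar_two V S hGR hGR₂ hGR₃ η₂ u =
      η₂ (UnitaryGroup.archToAdelic (↥(maximalRealSubfield L)) L (IsCMField.complexConj L) 3
        (Matrix.diagonal (frameD V)) (archSectionFrameOf V u), 1) *
        cmConjLineChar₀ (L : Type) finProdFinEquiv e₁ (frameD V) (frameD_real V) (frameD_ne V) (dW S) (dW_real S)
      (dW_ne S) (dW' S) (dW'_real S) (dW'_ne S) S.isoGL (isoGL_hg₀ S) hGR hGR₂ hGR₃
          (UnitaryGroup.archToAdelic (↥(maximalRealSubfield L)) L (IsCMField.complexConj L) 3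
          (Matrix.diagonal (frameD V)) (archSectionFrameOf V u), 1) :=
  rfl

/-- **Line 2 along E's chart**: `lineRepOf 2 (archInfOf V (expP b), 1) = cmArchWeilRep e₁ hGR_2 (archSectionFrameOf V (expP b), 1) ⊗ 1`
— the line scalar is trivial on `exp 𝔭` (`map_expP_eq_one`). -/
theorem lineRepOf_two_archInfOf_expP_one (hV : IsAnisotropic L V.Hm) (b : Fin 2 → ℂ) :
    lineRepOf V S hGR hGR₀ hGR₁ hGR₂ hGR₃ η₀ η₁ η₂ η₃ 2 (archInfOf V (expP b), 1) =
      adelicTensorEnd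
        (cmArchWeilRep (L : Type) e₁ (frameD V) (frameD_real V) (frameD_ne V) (lineVec (L : Type) (dW' S 0))
            (fun _ => dW'_real S 0) (fun _ => dW'_ne S 0) hGR₂ (archSectionFrameOf V (expP b), 1) :
          𝓢((Fin 3 → mixedSpace (↥(maximalRealSubfield L))), ℂ) →ₗ[ℂ] _)
        LinearMap.id := by
  rw [lineRepOf_two_archInfOf_one V S hGR hGR₀ hGR₁ hGR₂ hGR₃ η₀ η₁ η₂ η₃ hV (expP b)]
  have h1 := map_expP_eq_one (lineScalar_two V S hGR hGR₂ hGR₃ η₂) b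
  rw [lineScalar_two_apply] at h1
  rw [h1, Units.val_one, one_smul]

/-- the scalar of line 3 along the `ι₁`-section, as a character of `U(2,1)`:
`u ↦ η_3(x_u, 1) · χ_3(x_u, 1)`, `x_u = (archSectionFrameOf V u)_𝔸`. -/
def lineScalar_three : U21 →* ℂˣ :=
  (η₃.comp (MonoidHom.prod ((UnitaryGroup.archToAdelic (↥(maximalRealSubfield L)) L (IsCMField.complexConj L) 3
      (Matrix.diagonal (frameD V))).comp (archSectionFrameOf V)) 1)) *
    ((cmConjLineChar₁ (L : Type) finProdFinEquiv e₁ (frameD V) (frameD_real V) (frameD_ne V) (dW S) (dW_real S)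
      (dW_ne S) (dW' S) (dW'_real S) (dW'_ne S) S.isoGL (isoGL_hg₀ S) hGR hGR₂ hGR₃).comp
      (MonoidHom.prod ((UnitaryGroup.archToAdelic (↥(maximalRealSubfield L)) L (IsCMField.complexConj L) 3
      (Matrix.diagonal (frameD V))).comp (archSectionFrameOf V)) 1))

/-- (Ported verbatim from the HodgeCMPerL package; no docstring in the source.) -/
theorem lineScalar_three_apply (u : U21) :
    lineScalar_three V S hGR hGR₂ hGR₃ η₃ u =
      η₃ (UnitaryGroup.archToAdelic (↥(maximalRealSubfield L)) L (IsCMField.complexConj L) 3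
        (Matrix.diagonal (frameD V)) (archSectionFrameOf V u), 1) *
        cmConjLineChar₁ (L : Type) finProdFinEquiv e₁ (frameD V) (frameD_real V) (frameD_ne V) (dW S) (dW_real S)
      (dW_ne S) (dW' S) (dW'_real S) (dW'_ne S) S.isoGL (isoGL_hg₀ S) hGR hGR₂ hGR₃
          (UnitaryGroup.archToAdelic (↥(maximalRealSubfield L)) L (IsCMField.complexConj L) 3
          (Matrix.diagonal (frameD V)) (archSectionFrameOf V u), 1) :=
  rfl

/-- **Line 3 along E's chart**: `lineRepOf 3 (archInfOf V (expP b), 1) = cmArchWeilRep e₁ hGR_3 (archSectionFrameOf V (expP b), 1) ⊗ 1`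
— the line scalar is trivial on `exp 𝔭` (`map_expP_eq_one`). -/
theorem lineRepOf_three_archInfOf_expP_one (hV : IsAnisotropic L V.Hm) (b : Fin 2 → ℂ) :
    lineRepOf V S hGR hGR₀ hGR₁ hGR₂ hGR₃ η₀ η₁ η₂ η₃ 3 (archInfOf V (expP b), 1) =
      adelicTensorEnd
        (cmArchWeilRep (L : Type) e₁ (frameD V) (frameD_real V) (frameD_ne V) (lineVec (L : Type) (dW' S 1))
            (fun _ => dW'_real S 1) (fun _ => dW'_ne S 1) hGR₃ (archSectionFrameOf V (expP b), 1) :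
          𝓢((Fin 3 → mixedSpace (↥(maximalRealSubfield L))), ℂ) →ₗ[ℂ] _)
        LinearMap.id := by
  rw [lineRepOf_three_archInfOf_one V S hGR hGR₀ hGR₁ hGR₂ hGR₃ η₀ η₁ η₂ η₃ hV (expP b)]
  have h1 := map_expP_eq_one (lineScalar_three V S hGR hGR₂ hGR₃ η₃) b
  rw [lineScalar_three_apply] at h1
  rw [h1, Units.val_one, one_smul]

/-- **`u ↦ lineRepOf k (archInfOf V u, 1)` is pure-tensor** for every line `k` — the hypothesis `IsArchTensor (archRestr X k Γ₀)`
of `Model/ArchKTypePinTensor` / `hA` of `Model/ArchKTypeOf.archKTypeOf` at the honest adelic side (take `ωA := h.factor`,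
`IsArchTensor.eq_adelicTensorEnd_factor`; its values on any vector are the explicit operators of the four lemmas above,
`IsArchTensor.factor_apply`). -/
theorem isArchTensor_lineRepOf_comp_archInfOf (hV : IsAnisotropic L V.Hm) (k : Fin 4) :
    IsArchTensor ((lineRepOf V S hGR hGR₀ hGR₁ hGR₂ hGR₃ η₀ η₁ η₂ η₃ k).comp
      ((MonoidHom.inl _ _).comp (archInfOf V))) := by
  intro u
  rw [MonoidHom.comp_apply, MonoidHom.comp_apply, MonoidHom.inl_apply]
  fin_cases k
  · exact ⟨_, lineRepOf_zero_archInfOf_one V S hGR hGR₀ hGR₁ hGR₂ hGR₃ η₀ η₁ η₂ η₃ hV u⟩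
  · exact ⟨_, lineRepOf_one_archInfOf_one V S hGR hGR₀ hGR₁ hGR₂ hGR₃ η₀ η₁ η₂ η₃ hV u⟩
  · exact ⟨_, lineRepOf_two_archInfOf_one V S hGR hGR₀ hGR₁ hGR₂ hGR₃ η₀ η₁ η₂ η₃ hV u⟩
  · exact ⟨_, lineRepOf_three_archInfOf_one V S hGR hGR₀ hGR₁ hGR₂ hGR₃ η₀ η₁ η₂ η₃ hV u⟩


end ArchSideTerm

end HodgeCM.Model

end
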